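import Summits.HodgeConjecture.HodgeConjecture.Theses.EndoscopicMiddleDegree
import Summits.HodgeConjecture.HodgeConjecture.Theorems.NikulinSerreCarrier.Negative.OrientationTwist
import Literature.AlgebraicGeometry.HodgeTheory.ComplexGysinCorrespondence
import Literature.AlgebraicGeometry.HodgeTheory.GysinBaseChangeOfKunneth
import Literature.AlgebraicGeometry.HodgeTheory.AlgebraicClassesExteriorProduct
import Literature.AlgebraicGeometry.HodgeTheory.HardLefschetzThreefold
import Literature.AlgebraicGeometry.HodgeTheory.SupportedClassesRational

/-!
# `OrthogonalEnveloped` (stmt-HodgeConjecture-14300) · Negative · the envelope of an ALGEBRAIC class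

Negative knowledge for the crux `EndoscopicMiddleDegree.OrthogonalEnveloped` (route EndoscopicMiddleDegree,
rev 6, rank 4; standing disprover `refuter-cdisprove-stmt-HodgeConjecture-14300-0`, cycle 1, 2026-08-16; work
file `Cruxes/OrthogonalEnveloped/Disproof.lean`, findings F1/F1′). WHY THE CRUX RESISTS, kernel-checked: its
conclusion HOLDS for every rational `(n,n)`-class that is ALGEBRAIC (so a refutation of the crux refutes the
Hodge conjecture on the sector — companion file `Negative/NecessaryForTarget`).

* `exists_normalised_crossSq`, `conclusion_of_mem_algebraicClasses` — for `X` smooth projective of dimension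
  `2(m+1)` and a rational `(m+1,m+1)`-class `e` which is algebraic with `e ∪ e ≠ 0`, the normalised exterior
  square `γ = (pr₁₊pr₂^*(e ∪ e))⁻¹ · pr₁^*e ∪ pr₂^*e ∈ algebraicClasses (X ⊗ X) (2(m+1))` has action
  `P_γ(β) = (⟨β,e⟩/⟨e,e⟩)·e` (`pc_crossSq_apply`: associativity, graded commutativity, `pr₂^*`
  multiplicative, projection formula), which preserves rational classes for EVERY orientation family (the
  orientation scalar cancels in the ratio; `exists_ratCast_eq_of_isRationalClass_smul`), has image `ℂ · e` and
  fixes `e` — the conclusion of the crux for `e`, granted only that the fibre integral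
  `pr₁₊pr₂^* : H^{top}(X(ℂ)) → H⁰(X(ℂ))` is non-zero (Künneth; hypothesis `ht`).
* `conclusion_of_orthogonalFrame` — the same for every `ℚ`-combination of a cup-orthogonal frame of such
  classes (cross terms vanish, `pc_smul_crossSq_apply`): with HC and Hodge–Riemann non-degeneracy on `Hdg_ℚ`
  every rational Hodge class is enveloped, so the crux's hypothesis `e ⊥ TW(D)` is not load-bearing for its
  truth (only for the route's Hecke proof).

No hypothesis beyond the theorems' explicit ones; axioms `propext`, `Classical.choice`, `Quot.sound`.

## References

* [VoisinHodgeII2003] C. Voisin, Hodge Theory and Complex Algebraic Geometry II, CUP 2003, Prop. 9.20,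
  proof of Thm. 10.17 (10.7).
* [VoisinHodgeI2002] C. Voisin, Hodge Theory and Complex Algebraic Geometry I, CUP 2002, §7.1.1, Thm. 6.32, §11.3.
* [FultonYoungTableaux1997] W. Fulton, Young Tableaux, CUP 1997, App. B §B.1 (5)–(6).
* [HatcherAT2002] A. Hatcher, Algebraic Topology, CUP 2002, §3.2 Prop. 3.10, Thm. 3.11, §3.3 Thm. 3.26, 3.30.
-/

noncomputable section

-- The mandated namespace `Summit.<P>.<Sub>.Theorems.…` repeats `HodgeConjecture` (single-conjunct summit).
set_option linter.dupNamespace false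

namespace Summit.HodgeConjecture.HodgeConjecture.Theorems.OrthogonalEnveloped.Negative.EnvelopeOfAlgebraic

open CategoryTheory MonoidalCategory CartesianMonoidalCategory
open Literature.AlgebraicGeometry Literature.AlgebraicGeometry.Motives
  Literature.AlgebraicGeometry.HodgeTheory Literature.AlgebraicGeometry.ShimuraVarieties
  Literature.AlgebraicTopology.SingularHomology
open Summit.HodgeConjecture.HodgeConjecture.Theses.EndoscopicMiddleDegree (OrthogonalEnveloped)
open Summit.HodgeConjecture.HodgeConjecture.Theorems.NikulinSerreCarrier.Negative.OrientationTwist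
  (ratFamily isRationalClass_complexGysin_ratFamily)

universe u

variable {m : ℕ} {X : SchemeOver ℂ}

/-! ### Vocabulary: the correspondence action `P` and the fibre integral -/

/-- The correspondence action `P_γ β = pr₁₊(pr₂^* β ∪ γ)` of the crux (`pr₁₊ = complexGysin μ`), for a
smooth projective `X` of dimension `2(m+1)`: it is the tree's `corrAction μ hX hX rfl γ`, and agrees
with the crux's inline `let P` by `rfl` (`p_apply`). [cite: VoisinHodgeII2003, proof of Thm. 10.17 (10.7)] -/
abbrev Pc (μ : OrientationFamily) (hX : IsSmoothProjective (2 * (m + 1)) X)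
    (γ : complexBetti (X ⊗ X) (2 * (2 * (m + 1)))) :
    complexBetti X (2 * (m + 1)) →ₗ[ℂ] complexBetti X (2 * (m + 1)) :=
  corrAction μ hX hX (rfl : 2 * (m + 1) + 2 * (2 * (m + 1)) = 2 * (m + 1) + 2 * (2 * (m + 1))) γ

/-- `Pc` is literally the crux's `P`. [folklore] -/
theorem pc_apply (μ : OrientationFamily) (hX : IsSmoothProjective (2 * (m + 1)) X)
    (γ : complexBetti (X ⊗ X) (2 * (2 * (m + 1)))) (β : complexBetti X (2 * (m + 1))) :
    Pc μ hX γ β = complexGysin μ (IsSmoothProjective.tensor_holds hX hX) hX (fst X X)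
      (show 2 * (m + 1) + 2 * (2 * (m + 1)) + 2 * (2 * (m + 1)) =
        2 * (m + 1) + 2 * (2 * (m + 1) + 2 * (m + 1)) by ring)
      (cupProduct (rfl : 2 * (m + 1) + 2 * (2 * (m + 1)) = 2 * (m + 1) + 2 * (2 * (m + 1)))
        (complexBetti.map (snd X X) (2 * (m + 1)) β) γ) :=
  rfl

/-- The **fibre integral** `H^{top}(X(ℂ)) → H⁰(X(ℂ))`, `ω ↦ pr₁₊ pr₂^* ω`, of the product square
`X ⊗ X ⇉ X` (base change: `= π^* π_* ω = (∫_X ω) · 1` up to the orientation scalar).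
[cite: FultonYoungTableaux1997, Appendix B §B.1 (5)] -/
abbrev fibreIntegral (μ : OrientationFamily) (hX : IsSmoothProjective (2 * (m + 1)) X) :
    complexBetti X (2 * (2 * (m + 1))) →ₗ[ℂ] complexBetti X 0 :=
  complexGysin μ (IsSmoothProjective.tensor_holds hX hX) hX (fst X X)
      (show 2 * (2 * (m + 1)) + 2 * (2 * (m + 1)) = 0 + 2 * (2 * (m + 1) + 2 * (m + 1)) by ring) ∘ₗ
    (complexBetti.map (snd X X) (2 * (2 * (m + 1)))).hom

/-! ### The ratio of proportional rational classes is rational -/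

/-- If `e ≠ 0` and `s • e` are both rational classes then `s ∈ ℚ` (rational descent of linear
relations, `ringChange_mem_span_image_iff`: `ℂ·ι(ℚ x) ∩ ι H(ℚ) = ι(ℚ x)`). [cite: VoisinHodgeI2002, §7.1.1] -/
theorem exists_ratCast_eq_of_isRationalClass_smul {Y : Type u} [TopologicalSpace Y] {k : ℕ}
    {e : singularCohomology ℂ ℂ Y k} (he : IsRationalClass e) (hne : e ≠ 0) {s : ℂ}
    (hs : IsRationalClass (s • e)) : ∃ q : ℚ, (q : ℂ) = s := by
  obtain ⟨x, rfl⟩ := he.exists_ringChange_eq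
  obtain ⟨y, hy⟩ := hs.exists_ringChange_eq
  have hmem : singularCohomology.ringChange (algebraMap ℚ ℂ) Y k y ∈
      Submodule.span ℂ (singularCohomology.ringChange (algebraMap ℚ ℂ) Y k ''
        ((ℚ ∙ x : Submodule ℚ _) : Set (singularCohomology ℚ ℚ Y k))) := by
    rw [hy]
    exact Submodule.smul_mem _ _ (Submodule.subset_span
      ⟨x, Submodule.mem_span_singleton_self x, rfl⟩)
  rw [ringChange_mem_span_image_iff] at hmem
  obtain ⟨q, rfl⟩ := Submodule.mem_span_singleton.1 hmem
  refine ⟨q, ?_⟩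
  rw [ringChange_ratCast_smul] at hy
  have h : ((q : ℂ) - s) • singularCohomology.ringChange (algebraMap ℚ ℂ) Y k x = 0 := by
    rw [sub_smul, hy, sub_self]
  exact sub_eq_zero.1 ((smul_eq_zero.1 h).resolve_right hne)


/-! ### The rank-one correspondence `pr₁^* e ∪ pr₂^* e` -/

/-- `2(m+1) + 2(m+1) = 2·2(m+1)`: the degree of `e ∪ e` written as a top degree `2 · dim X`. [folklore] -/
theorem two_add_two (m : ℕ) : 2 * (m + 1) + 2 * (m + 1) = 2 * (2 * (m + 1)) := by ring

/-- The exterior square `pr₁^* e ∪ pr₂^* e ∈ H^{4n}((X ⊗ X)(ℂ))` of a middle-degree class `e`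
(Voisin II, proof of Prop. 9.20: "`[Z × Z'] = pr_1^*[Z] ∪ pr_2^*[Z']`"). [cite: VoisinHodgeII2003, Prop. 9.20] -/
abbrev crossSq (e : complexBetti X (2 * (m + 1))) : complexBetti (X ⊗ X) (2 * (2 * (m + 1))) :=
  cupProduct (two_add_two m) (complexBetti.map (fst X X) (2 * (m + 1)) e)
    (complexBetti.map (snd X X) (2 * (m + 1)) e)

/-- **`P_{e ⊠ e}(β) = e ∪ pr₁₊ pr₂^*(β ∪ e)`**: `pr₂^*β ∪ (pr₁^*e ∪ pr₂^*e) = pr₁^*e ∪ pr₂^*(β ∪ e)`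
(associativity, graded commutativity in even degrees, multiplicativity of `pr₂^*`) and the projection
formula `pr₁₊(pr₁^* e ∪ y) = e ∪ pr₁₊ y`. [cite: FultonYoungTableaux1997, Appendix B §B.1 (6)]
[cite: HatcherAT2002, §3.2 Prop. 3.10 and Thm. 3.11] -/
theorem pc_crossSq_apply (μ : OrientationFamily) (hX : IsSmoothProjective (2 * (m + 1)) X)
    (e β : complexBetti X (2 * (m + 1))) :
    Pc μ hX (crossSq e) β =
      cupProduct (Nat.add_zero _) e (fibreIntegral μ hX (cupProduct (two_add_two m) β e)) := by
  have hS : 2 * (2 * (m + 1)) + 2 * (m + 1) = 2 * (m + 1) + 2 * (2 * (m + 1)) := by ring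
  have h1 : cupProduct (rfl : 2 * (m + 1) + 2 * (2 * (m + 1)) = 2 * (m + 1) + 2 * (2 * (m + 1)))
      (complexBetti.map (snd X X) (2 * (m + 1)) β) (crossSq e) =
      cupProduct (rfl : 2 * (m + 1) + 2 * (2 * (m + 1)) = 2 * (m + 1) + 2 * (2 * (m + 1)))
        (complexBetti.map (fst X X) (2 * (m + 1)) e)
        (complexBetti.map (snd X X) (2 * (2 * (m + 1))) (cupProduct (two_add_two m) β e)) := by
    rw [crossSq, ← cupProduct_assoc (two_add_two m) (two_add_two m) hS rfl,
      cupProduct_gradedComm_holds ℂ _ (two_add_two m) (two_add_two m)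
        (complexBetti.map (snd X X) (2 * (m + 1)) β) (complexBetti.map (fst X X) (2 * (m + 1)) e),
      show ((-1 : ℂ) ^ (2 * (m + 1) * (2 * (m + 1)))) = 1 by
        rw [show 2 * (m + 1) * (2 * (m + 1)) = 2 * ((m + 1) * (2 * (m + 1))) by ring, pow_mul,
          neg_one_sq, one_pow],
      one_smul, cupProduct_assoc (two_add_two m) (two_add_two m) hS rfl, cupProduct_map]
  rw [pc_apply, h1, complexGysin_cup (OrientationFamily.hasPoincareDuality μ)
    (IsSmoothProjective.tensor_holds hX hX) hX (fst X X) rfl _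
    (show 2 * (2 * (m + 1)) + 2 * (2 * (m + 1)) = 0 + 2 * (2 * (m + 1) + 2 * (m + 1)) by ring)
    (Nat.add_zero _)]
  rfl

/-- Scalar form: `pr₁₊ pr₂^*(β ∪ e) = s · 1` (`H⁰(X(ℂ); ℂ) = ℂ · 1`, `X(ℂ)` connected) and then
`P_{e ⊠ e}(β) = s · e`. [cite: HatcherAT2002, §3.3 Thm. 3.26] -/
theorem exists_pc_crossSq_eq_smul (μ : OrientationFamily) (hX : IsSmoothProjective (2 * (m + 1)) X)
    (e β : complexBetti X (2 * (m + 1))) :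
    ∃ s : ℂ, fibreIntegral μ hX (cupProduct (two_add_two m) β e) =
        s • singularCohomology.one ℂ (ComplexPoints X) ∧
      Pc μ hX (crossSq e) β = s • e := by
  obtain ⟨s, hs⟩ := exists_eq_smul_one μ hX (fibreIntegral μ hX (cupProduct (two_add_two m) β e))
  refine ⟨s, hs, ?_⟩
  rw [pc_crossSq_apply, hs, map_smul, cupProduct_one]

/-- `P_{ratFamily, e ⊠ e}` preserves rational classes for `e` rational (pull-backs, cup products and
the rationally normalised Gysin morphisms preserve rationality). [cite: VoisinHodgeI2002, §7.3.2] -/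
theorem isRationalClass_pc_ratFamily_crossSq (hX : IsSmoothProjective (2 * (m + 1)) X)
    {e β : complexBetti X (2 * (m + 1))} (he : IsRationalClass e) (hβ : IsRationalClass β) :
    IsRationalClass (Pc ratFamily hX (crossSq e) β) := by
  rw [pc_apply]
  exact isRationalClass_complexGysin_ratFamily _ _ _ _
    ((hβ.map _).cup _ ((he.map _).cup _ (he.map _)))

/-- Closed form of the action of a rescaled exterior square: `P_{c • e⊠e} β = c • (e ∪ pr₁₊pr₂^*(β ∪ e))`.
[cite: FultonYoungTableaux1997, Appendix B §B.1 (6)] -/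
theorem pc_smul_crossSq_apply (μ : OrientationFamily) (hX : IsSmoothProjective (2 * (m + 1)) X)
    (c : ℂ) (e β : complexBetti X (2 * (m + 1))) :
    Pc μ hX (c • crossSq e) β =
      c • cupProduct (Nat.add_zero _) e (fibreIntegral μ hX (cupProduct (two_add_two m) β e)) := by
  rw [← pc_crossSq_apply]
  change corrAction μ hX hX rfl (c • crossSq e) β = c • corrAction μ hX hX rfl (crossSq e) β
  rw [map_smul, LinearMap.smul_apply]

/-- **The normalised exterior square of an ALGEBRAIC class (the conclusion of the crux follows from HC).**
Let `X` be smooth projective of dimension `2(m+1)`, `e ∈ H^{2(m+1)}(X(ℂ); ℂ)` rational, ALGEBRAIC, with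
`e ∪ e ≠ 0` (Hodge–Riemann for a primitive `e`; this is where `e ⊥ TW(D)` is used on paper), and assume the
fibre integral `pr₁₊ pr₂^*` is non-zero on `H^{top}(X(ℂ))` (Künneth / `[X × X] = [X] × [X]`). Then for
`c := (pr₁₊pr₂^*(e ∪ e))⁻¹` the class `γ := c • pr₁^* e ∪ pr₂^* e` is algebraic on `X ⊗ X` (exterior products
of algebraic classes) and `P_γ(β) = (⟨β, e⟩ / ⟨e, e⟩) · e` preserves rational classes (the orientation scalar
cancels in the ratio), takes values in `ℂ · e` and fixes `e` — for EVERY orientation family.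
[cite: VoisinHodgeII2003, Prop. 9.20 and proof of Thm. 10.17 (10.7)] [cite: FultonYoungTableaux1997, Appendix B §B.1 (5)–(6)] -/
theorem exists_normalised_crossSq (μ : OrientationFamily) (hX : IsSmoothProjective (2 * (m + 1)) X)
    (ht : ∃ ω : complexBetti X (2 * (2 * (m + 1))), fibreIntegral μ hX ω ≠ 0)
    {e : complexBetti X (2 * (m + 1))} (he : IsRationalClass e)
    (halg : e ∈ algebraicClasses X (m + 1)) (hee : cupProduct (two_add_two m) e e ≠ 0) :
    ∃ c : ℂ, c • crossSq e ∈ algebraicClasses (X ⊗ X) (2 * (m + 1)) ∧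
      (∀ β, IsRationalClass β → IsRationalClass (Pc μ hX (c • crossSq e) β)) ∧
      (∀ β, ∃ s : ℂ, Pc μ hX (c • crossSq e) β = s • e) ∧
      Pc μ hX (c • crossSq e) e = e := by
  classical
  have hμ : μ.HasPoincareDuality := OrientationFamily.hasPoincareDuality μ
  have hne : e ≠ 0 := by rintro rfl; exact hee (by rw [map_zero])
  -- the scalars `s β`: `pr₁₊ pr₂^*(β ∪ e) = s β · 1`, `P₀ β = s β · e`
  choose s hs1 hs2 using exists_pc_crossSq_eq_smul μ hX e
  -- `s e ≠ 0`: `e ∪ e` spans the top line, on which the fibre integral is non-zero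
  obtain ⟨ω, hω⟩ := ht
  have hω0 : ω ≠ 0 := by rintro rfl; exact hω (map_zero _)
  obtain ⟨r, hr⟩ := exists_eq_smul_of_top μ hX hω0 (cupProduct (two_add_two m) e e)
  have hr0 : r ≠ 0 := by rintro rfl; exact hee (by rw [hr, zero_smul])
  have hse : s e ≠ 0 := by
    intro h0
    have h1 := hs1 e
    rw [h0, zero_smul, hr, map_smul] at h1
    exact (smul_ne_zero hr0 hω) h1
  -- comparison with the rationally normalised family: `P₀^μ = c • P₀^{rat}`
  obtain ⟨c, hc0, hc⟩ := corrAction_eq_smul_of_orientationFamily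
    (OrientationFamily.hasPoincareDuality ratFamily) hμ hX hX
    (rfl : 2 * (m + 1) + 2 * (2 * (m + 1)) = 2 * (m + 1) + 2 * (2 * (m + 1)))
  have hrat : ∀ β, IsRationalClass β → ∃ q : ℚ, (q : ℂ) = c⁻¹ * s β := by
    intro β hβ
    refine exists_ratCast_eq_of_isRationalClass_smul he hne ?_
    have h2 : Pc μ hX (crossSq e) β = c • Pc ratFamily hX (crossSq e) β := by
      change corrAction μ hX hX rfl (crossSq e) β = c • corrAction ratFamily hX hX rfl (crossSq e) β
      rw [hc, LinearMap.smul_apply, LinearMap.smul_apply]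
    have h3 : (c⁻¹ * s β) • e = Pc ratFamily hX (crossSq e) β := by
      rw [mul_smul, ← hs2 β, h2, smul_smul, inv_mul_cancel₀ hc0, one_smul]
    rw [h3]
    exact isRationalClass_pc_ratFamily_crossSq hX he hβ
  have h4 : ∀ β, Pc μ hX ((s e)⁻¹ • crossSq e) β = ((s e)⁻¹ * s β) • e := by
    intro β
    change corrAction μ hX hX rfl ((s e)⁻¹ • crossSq e) β = _
    rw [map_smul, LinearMap.smul_apply, mul_smul]
    exact congrArg _ (hs2 β)
  -- the normalised correspondence
  refine ⟨(s e)⁻¹, ?_, ?_, fun β ↦ ⟨_, h4 β⟩, ?_⟩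
  · refine Submodule.smul_mem _ _ ?_
    have h := cupProduct_map_fst_map_snd_mem_supportedClasses hX hX (two_add_two m) halg halg
    rwa [← two_mul] at h
  · intro β hβ
    obtain ⟨qβ, hqβ⟩ := hrat β hβ
    obtain ⟨qe, hqe⟩ := hrat e he
    have hq : ((qβ / qe : ℚ) : ℂ) = (s e)⁻¹ * s β := by
      push_cast
      rw [hqβ, hqe]
      field_simp
    rw [h4, ← hq]
    exact he.smul _
  · rw [h4, inv_mul_cancel₀ hse, one_smul]

/-- **The envelope of an ALGEBRAIC class**: the conclusion of the crux for `e` rational, of type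
`(m+1,m+1)`, algebraic with `e ∪ e ≠ 0`, every orientation family (from `exists_normalised_crossSq`). So a
refutation of the crux produces a non-algebraic rational Hodge class on a ball quotient, i.e. refutes the Hodge
conjecture on the sector. [cite: VoisinHodgeII2003, Prop. 9.20 and proof of Thm. 10.17 (10.7)] -/
theorem conclusion_of_mem_algebraicClasses (μ : OrientationFamily)
    (hX : IsSmoothProjective (2 * (m + 1)) X)
    (ht : ∃ ω : complexBetti X (2 * (2 * (m + 1))), fibreIntegral μ hX ω ≠ 0)
    {e : complexBetti X (2 * (m + 1))} (he : IsRationalClass e)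
    (htyp : IsOfHodgeType (2 * (m + 1)) X (2 * (m + 1)) (m + 1) (m + 1) e)
    (halg : e ∈ algebraicClasses X (m + 1)) (hee : cupProduct (two_add_two m) e e ≠ 0) :
    ∃ γ ∈ algebraicClasses (X ⊗ X) (2 * (m + 1)),
      (∀ β, IsRationalClass β → IsRationalClass (Pc μ hX γ β)) ∧
      (∀ β, IsOfHodgeType (2 * (m + 1)) X (2 * (m + 1)) (m + 1) (m + 1) (Pc μ hX γ β)) ∧
      Pc μ hX γ e = e := by
  obtain ⟨c, hγ, hR, hline, hfix⟩ := exists_normalised_crossSq μ hX ht he halg hee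
  obtain ⟨A, hA⟩ := htyp
  refine ⟨c • crossSq e, hγ, hR, fun β ↦ ⟨A, ?_⟩, hfix⟩
  obtain ⟨s, hs⟩ := hline β
  rw [hs, map_smul]
  exact Submodule.smul_mem _ _ hA

/-! ### F1′ — envelopes from an orthogonal ALGEBRAIC frame (`e ⊥ TW(D)` is not load-bearing for truth) -/

/-- **Envelope of a class in the `ℚ`-span of an orthogonal algebraic frame.** Let `f₁, …, f_r` be rational,
ALGEBRAIC classes of type `(m+1,m+1)` in one Hodge model, pairwise cup-orthogonal, with `fᵢ ∪ fᵢ ≠ 0` (an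
anisotropic orthogonal basis — every non-degenerate `ℚ`-quadratic space has one). Then every `ℚ`-combination
`e = Σ aᵢ fᵢ` is enveloped: `γ := Σ cᵢ • (pr₁^*fᵢ ∪ pr₂^*fᵢ)` is algebraic and `P_γ = Σ P_{γᵢ}` preserves
rational classes, is `(m+1,m+1)`-valued and fixes `e` (the cross terms `P_{γᵢ} f_k`, `k ≠ i`, vanish by
`pc_smul_crossSq_apply`), for EVERY orientation family. With HC on `X` in degree `2(m+1)` and the
non-degeneracy of the cup pairing on `Hdg_ℚ` (Hodge–Riemann on the rational Lefschetz pieces) this envelopes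
EVERY rational Hodge class: the hypothesis `e ⊥ TW(D)` of the crux is not load-bearing for its TRUTH (F4) —
only for the route's Hecke proof and for the seeds of `IsotypicMiddleClassesAlgebraic`.
[cite: VoisinHodgeI2002, Thm. 6.32 and §11.3] [cite: VoisinHodgeII2003, Prop. 9.20] -/
theorem conclusion_of_orthogonalFrame (μ : OrientationFamily) (hX : IsSmoothProjective (2 * (m + 1)) X)
    (ht : ∃ ω : complexBetti X (2 * (2 * (m + 1))), fibreIntegral μ hX ω ≠ 0) {r : ℕ}
    (f : Fin r → complexBetti X (2 * (m + 1))) (hrat : ∀ i, IsRationalClass (f i))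
    (halg : ∀ i, f i ∈ algebraicClasses X (m + 1)) (A : HodgeModel (2 * (m + 1)) X)
    (htyp : ∀ i, A.pullback (2 * (m + 1)) (f i) ∈ A.hodgePQ (2 * (m + 1)) (m + 1) (m + 1))
    (horth : ∀ i j, i ≠ j → cupProduct (two_add_two m) (f i) (f j) = 0)
    (hdiag : ∀ i, cupProduct (two_add_two m) (f i) (f i) ≠ 0) (a : Fin r → ℚ) :
    ∃ γ ∈ algebraicClasses (X ⊗ X) (2 * (m + 1)),
      (∀ β, IsRationalClass β → IsRationalClass (Pc μ hX γ β)) ∧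
      (∀ β, IsOfHodgeType (2 * (m + 1)) X (2 * (m + 1)) (m + 1) (m + 1) (Pc μ hX γ β)) ∧
      Pc μ hX γ (∑ i, ((a i : ℚ) : ℂ) • f i) = ∑ i, ((a i : ℚ) : ℂ) • f i := by
  classical
  choose c hc1 hc2 hc3 hc4 using fun i ↦ exists_normalised_crossSq μ hX ht (hrat i) (halg i) (hdiag i)
  -- the sum of the single envelopes and its action
  have hsum : ∀ β, Pc μ hX (∑ i, c i • crossSq (f i)) β = ∑ i, Pc μ hX (c i • crossSq (f i)) β := by
    intro β
    change corrAction μ hX hX rfl (∑ i, c i • crossSq (f i)) β = _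
    rw [map_sum, LinearMap.sum_apply]
  -- cross terms vanish
  have hcross : ∀ i k, i ≠ k → Pc μ hX (c i • crossSq (f i)) (f k) = 0 := by
    intro i k hik
    rw [pc_smul_crossSq_apply, horth k i (Ne.symm hik), map_zero, map_zero, smul_zero]
  have hfix : ∀ k, Pc μ hX (∑ i, c i • crossSq (f i)) (f k) = f k := by
    intro k
    rw [hsum, Finset.sum_eq_single k (fun i _ hik ↦ hcross i k hik) (fun h ↦ (h (Finset.mem_univ k)).elim),
      hc4 k]
  -- finite sums of rational classes are rational
  have hratsum : ∀ (g : Fin r → complexBetti X (2 * (m + 1))), (∀ i, IsRationalClass (g i)) →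
      IsRationalClass (∑ i, g i) := by
    intro g hg
    have h := IsRationalClass.sum_smul Finset.univ hg (fun _ ↦ (1 : ℚ))
    simpa only [Rat.cast_one, one_smul] using h
  refine ⟨∑ i, c i • crossSq (f i), Submodule.sum_mem _ fun i _ ↦ hc1 i, ?_, ?_, ?_⟩
  · intro β hβ
    rw [hsum]
    exact hratsum _ fun i ↦ hc2 i β hβ
  · intro β
    refine ⟨A, ?_⟩
    rw [hsum, map_sum]
    refine Submodule.sum_mem _ fun i _ ↦ ?_
    obtain ⟨t, hts⟩ := hc3 i β
    rw [hts, map_smul]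
    exact Submodule.smul_mem _ _ (htyp i)
  · rw [map_sum]
    refine Finset.sum_congr rfl fun k _ ↦ ?_
    rw [map_smul, hfix k]

end Summit.HodgeConjecture.HodgeConjecture.Theorems.OrthogonalEnveloped.Negative.EnvelopeOfAlgebraic

end
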